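import Summits.BirchSwinnertonDyer.BirchSwinnertonDyer.Theorems.KimAtThreeShallowEqDeepOffStratumSockets
import Summits.BirchSwinnertonDyer.BirchSwinnertonDyer.Theorems.KimAtThreeDeepLowerSplitGlueItem
import HarnessLib

/-!
# Route `KimAtThreeKolyvagin` (rung W2), crux `ShallowEqDeepAtTorsionFree` (item 19077) and the LEAF
# `N11.KimAtThreeRankZeroPUB`: the residual (R) in the leaf's own currency — the leaf needs exactly TWO
# inputs, `DeepUpperAtThree` (19076) and (R); 19077 BY NAME from the five shared parts, 19562 and (R)

Cell `bsd-addord`, seat `bsd-addord-w2-c4` (gen 6; item of record `stmt-BirchSwinnertonDyer-19077`, owner of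
its §S child 19599). Companion of `KimAtThreeShallowEqDeepOffStratumResidual` (the same residual at the
off-stratum crux 19599 in optimal-datum currency). Notation at a tower row `(W, f)` (`f` the newform of
`W`, `E(ℚ₃)[3] = 0`, analytic rank `0`): `a = ∂⁽⁰⁾(δ̃)`, `s = ord₃ #Ш(E/ℚ)(3)`, `d = ∂^{(∞)}_{deep}(δ̃)`,
`∂ = ∂^{(∞)}(δ̃)` (all cyclic levels); always `∂ ≤ d ≤ a` (`kuriharaPartialInfty_le_kuriharaPartialDeepInfty`,
`kuriharaPartialDeepInfty_le_kuriharaPartial_zero`).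

THE RESIDUAL (R) in `f`-currency (hypothesis `hR` below; binders = the LEAF's binders verbatim, conclusion
`a ≤ s + ∂`): «`3^{a−s}` divides EVERY cyclic-level Kurihara number of `f`» — Kim's clause (6)
`length Ш[p^∞] = ∂⁽⁰⁾ − ∂^{(∞)}`, LOWER-BOUND half, at `p = 3` (Amer. J. Math. 148 Thm. 1.9 (6) is `p ≥ 5`;
announced at `3` = Kim 2025 Thm. 1.1; g0's threshold-free certificate lane (C) of
`KimAtThreeShallowEqDeepCertificateBound` in closed form).

* §1 `kimAtThreeRankZeroPUB_of_upper_of_residual` / `…_of_deepUpperAtThree_of_residual`: **the LEAF ⟸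
  UPPER inequality (crux 19076 `DeepUpperAtThree`) ∧ (R)** — at a row `s + d ≤ a ≤ s + ∂ ≤ s + d` forces
  `a = s + d` and `∂ = d`. So of the route's three cruxes, `DeepLowerAtThree` (19075) and
  `ShallowEqDeepAtTorsionFree` (19077) are TOGETHER replaced by the single statement (R) for the purpose of
  the leaf (which only sees `E(ℚ₃)[3] = 0` rows); conversely 19075 ∧ 19077 ⟹ (R)
  (`residual_of_deepLower_of_shallowEqDeep`) and (R) ⟹ 19075 on its `E(ℚ₃)[3] = 0` rows, 19076 ∧ (R) ⟹ 19077
  BY NAME (`shallowEqDeepAtTorsionFree_of_deepUpperAtThree_of_residual`).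
* §2 `shallowEqDeepAtTorsionFree_of_sharedParts_of_deepUpperOff_of_residualOff`: **crux 19077 BY NAME ⟸ the
  five no-stub shared parts `KatoStratumSharedParts` (alias 19678: Sakamoto ×2, GZK, Poitou–Tate, Carayol,
  PORT″ 19560) ∧ crux 19562 `DeepUpperAtThreeOffKatoStratum` ∧ (R) restricted to the off-stratum rows** (the
  optimal-datum form displayed in `KimAtThreeShallowEqDeepOffStratumResidual`) — the seam the planner can file
  when the off-stratum family is declared residual: no stub child (19561), no 19599, no 19679.

HONEST FRAMING. Theorems only (`ℕ∞` bookkeeping + composition of landed glues: w2-c4 g4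
`shallowEqDeepAtTorsionFree_of_parts_noStub` via w2-c2 g4 `shallowEqDeepAtTorsionFree_of_katoStratumSharedParts`,
and w2-c4 g5's row socket `shallowEqDeep_conclusion_of_upperRow_of_le_add_partialInfty`); every crux / alias / (R) is a
displayed hypothesis BY NAME or verbatim; nothing asserted about any curve; nothing booked; 19077, 19599,
19562, 19560 stay OPEN; BSD is not proved by any of this. (R) is not in print at `p = 3`.

References: [Kim2022StructureSelmer] Thm. 1.9 (6), §1.5.1; [Kim2025RefinedTNC] Thm. 1.1; [MazurRubin2004]
Def. 5.2.11, Thm. 5.2.12 (i).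
-/

set_option autoImplicit false
-- the Theorems namespace of a single-conjunct summit repeats the summit name by design (D-0017)
set_option linter.dupNamespace false

noncomputable section

open scoped MatrixGroups ModularForm Classical

open CongruenceSubgroup WeierstrassCurve Literature.NumberTheory.EllipticCurves
  Literature.NumberTheory.EllipticCurves.ModularForms
  Literature.NumberTheory.EllipticCurves.Rank1Residual

namespace Summit.BirchSwinnertonDyer.BirchSwinnertonDyer.Theorems.KimAtThreeShallowEqDeepResidualLeaf

open Summit.BirchSwinnertonDyer.Rank1Residual
open Summit.BirchSwinnertonDyer.Rank1Residual.Additive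
open Summit.BirchSwinnertonDyer.BirchSwinnertonDyer.Theses.KimAtThreeKolyvagin
open Summit.BirchSwinnertonDyer.BirchSwinnertonDyer.Theorems.KimAtThreeKolyvaginUnitLevelOneRungs
open Summit.BirchSwinnertonDyer.BirchSwinnertonDyer.Theorems.KimAtThreeKolyvaginCertificateDictionary
open Summit.BirchSwinnertonDyer.BirchSwinnertonDyer.Theorems.KimAtThreeShallowEqDeepOffStratumSockets
open Summit.BirchSwinnertonDyer.BirchSwinnertonDyer.Theorems.KimAtThreeDeepLowerSplitGlueItem

/-! ### §1 The leaf from the UPPER inequality and (R) -/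

/-- **LEAF ⟸ UPPER inequality ∧ (R).** `hU` = the body of crux `DeepUpperAtThree` (19076) verbatim
(`∂^{(∞)}_{deep} = d ∈ ℕ` and `s + d ≤ ∂⁽⁰⁾`, every tower row); `hR` = the residual (R) on the leaf's rows
(`E(ℚ₃)[3] = 0`): `∂⁽⁰⁾ ≤ s + ∂^{(∞)}`. At a row `s + d ≤ a ≤ s + ∂ ≤ s + d`, so `a = s + d` and `∂ = d`,
which is the leaf `N11.KimAtThreeRankZeroPUB` («`∂^{(∞)}(δ̃) = d` and `∂⁽⁰⁾(δ̃) = ord₃ #Ш(E/ℚ)(3) + d`»).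
[cite: Kim2022StructureSelmer, Thm. 1.9 (6), §1.5.1 (PDF p. 7)] [cite: MazurRubin2004, Def. 5.2.11, Thm. 5.2.12 (i)] -/
theorem kimAtThreeRankZeroPUB_of_upper_of_residual
    (hU : ∀ (W : WeierstrassCurve ℚ) [W.IsElliptic] [W.IsGloballyMinimal],
        (∀ n : ℕ, W.HasSurjectiveModNGaloisRep (3 ^ n : ℕ)) →
        Finite W.sha →
        ∀ {N : ℕ} [NeZero N] (f : CuspForm (Gamma0 N) 2), IsNewformOf W f →
        (∀ r : ℚ, ratPlusSymbol f r ≠ 0 → 0 ≤ padicValRat 3 (ratPlusSymbol f r)) →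
        kuriharaVanishingOrder W 3 f = 0 →
          ∃ d : ℕ, kuriharaPartialDeepInfty W 3 f = d ∧
            ((padicValNat 3 (Nat.card (AddCommGroup.primaryComponent W.sha 3)) + d : ℕ) : ℕ∞) ≤
              kuriharaPartial W 3 f 0)
    (hR : ∀ (W : WeierstrassCurve ℚ) [W.IsElliptic] [W.IsGloballyMinimal],
        (∀ n : ℕ, W.HasSurjectiveModNGaloisRep (3 ^ n : ℕ)) →
        Nat.card {Q : (W.baseChange ℚ_[3]).toAffine.Point // (3 : ℕ) • Q = 0} = 1 →
        Finite W.sha →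
        ∀ {N : ℕ} [NeZero N] (f : CuspForm (Gamma0 N) 2), IsNewformOf W f →
        (∀ r : ℚ, ratPlusSymbol f r ≠ 0 → 0 ≤ padicValRat 3 (ratPlusSymbol f r)) →
        kuriharaVanishingOrder W 3 f = 0 →
          kuriharaPartial W 3 f 0 ≤
            (padicValNat 3 (Nat.card (AddCommGroup.primaryComponent W.sha 3)) : ℕ∞) +
              kuriharaPartialInfty W 3 f) :
    N11.KimAtThreeRankZeroPUB := by
  intro W _ _ htower ht0 hfin N _ f hf hint hord
  obtain ⟨d, hd, hge⟩ := hU W htower hfin f hf hint hord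
  have hle := hR W htower ht0 hfin f hf hint hord
  set s := padicValNat 3 (Nat.card (AddCommGroup.primaryComponent W.sha 3)) with hs
  -- `∂ ≤ d`
  have hpd : kuriharaPartialInfty W 3 f ≤ (d : ℕ∞) := by
    rw [← hd]
    exact kuriharaPartialInfty_le_kuriharaPartialDeepInfty W 3 f
  -- hence `∂` is a natural number `j ≤ d`
  have hptop : kuriharaPartialInfty W 3 f ≠ ⊤ := ne_top_of_le_ne_top (ENat.coe_ne_top d) hpd
  obtain ⟨j, hj⟩ : ∃ j : ℕ, kuriharaPartialInfty W 3 f = j :=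
    (ENat.ne_top_iff_exists.mp hptop).imp fun j h => h.symm
  have hjd : j ≤ d := by
    rw [hj] at hpd
    exact_mod_cast hpd
  -- `s + d ≤ a ≤ s + j`, so `d ≤ j`
  have hchain : ((s + d : ℕ) : ℕ∞) ≤ (s : ℕ∞) + (j : ℕ∞) := by
    rw [← hj]
    exact hge.trans hle
  have hdj : d ≤ j := by
    have : s + d ≤ s + j := by exact_mod_cast hchain
    omega
  have hjd' : j = d := le_antisymm hjd hdj
  refine ⟨d, ?_, le_antisymm ?_ hge⟩
  · rw [hj, hjd']
  · calc kuriharaPartial W 3 f 0 ≤ (s : ℕ∞) + kuriharaPartialInfty W 3 f := hle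
      _ = ((s + d : ℕ) : ℕ∞) := by rw [hj, hjd', Nat.cast_add]

/-- **LEAF ⟸ crux 19076 `DeepUpperAtThree` (BY NAME) ∧ (R).** [cite: Kim2022StructureSelmer, Thm. 1.9 (6)]
[cite: Kim2025RefinedTNC, Thm. 1.1] -/
theorem kimAtThreeRankZeroPUB_of_deepUpperAtThree_of_residual (hU : DeepUpperAtThree)
    (hR : ∀ (W : WeierstrassCurve ℚ) [W.IsElliptic] [W.IsGloballyMinimal],
        (∀ n : ℕ, W.HasSurjectiveModNGaloisRep (3 ^ n : ℕ)) →
        Nat.card {Q : (W.baseChange ℚ_[3]).toAffine.Point // (3 : ℕ) • Q = 0} = 1 →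
        Finite W.sha →
        ∀ {N : ℕ} [NeZero N] (f : CuspForm (Gamma0 N) 2), IsNewformOf W f →
        (∀ r : ℚ, ratPlusSymbol f r ≠ 0 → 0 ≤ padicValRat 3 (ratPlusSymbol f r)) →
        kuriharaVanishingOrder W 3 f = 0 →
          kuriharaPartial W 3 f 0 ≤
            (padicValNat 3 (Nat.card (AddCommGroup.primaryComponent W.sha 3)) : ℕ∞) +
              kuriharaPartialInfty W 3 f) :
    N11.KimAtThreeRankZeroPUB :=
  kimAtThreeRankZeroPUB_of_upper_of_residual hU hR

/-- **Necessity: 19075 `DeepLowerAtThree` ∧ 19077 `ShallowEqDeepAtTorsionFree` ⟹ (R)** (`a ≤ s + d ≤ s + ∂`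
at every row with `E(ℚ₃)[3] = 0`): (R) is exactly the merge of the two cruxes on the leaf's rows.
[cite: Kim2022StructureSelmer, Thm. 1.9 (6), §1.5.1 (PDF p. 7)] -/
theorem residual_of_deepLower_of_shallowEqDeep (hL : DeepLowerAtThree)
    (hS : ShallowEqDeepAtTorsionFree) :
    ∀ (W : WeierstrassCurve ℚ) [W.IsElliptic] [W.IsGloballyMinimal],
        (∀ n : ℕ, W.HasSurjectiveModNGaloisRep (3 ^ n : ℕ)) →
        Nat.card {Q : (W.baseChange ℚ_[3]).toAffine.Point // (3 : ℕ) • Q = 0} = 1 →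
        Finite W.sha →
        ∀ {N : ℕ} [NeZero N] (f : CuspForm (Gamma0 N) 2), IsNewformOf W f →
        (∀ r : ℚ, ratPlusSymbol f r ≠ 0 → 0 ≤ padicValRat 3 (ratPlusSymbol f r)) →
        kuriharaVanishingOrder W 3 f = 0 →
          kuriharaPartial W 3 f 0 ≤
            (padicValNat 3 (Nat.card (AddCommGroup.primaryComponent W.sha 3)) : ℕ∞) +
              kuriharaPartialInfty W 3 f := by
  intro W _ _ htower ht0 hfin N _ f hf hint hord
  obtain ⟨d, hd, hle⟩ := hL W htower hfin f hf hint hord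
  refine hle.trans ?_
  rw [Nat.cast_add, ← hd]
  exact add_le_add le_rfl (hS W htower ht0 hfin f hf hint hord)

/-- **(R) ⟹ crux 19075 `DeepLowerAtThree` on its `E(ℚ₃)[3] = 0` rows** (displayed: 19075's body with the
binder `#E(ℚ₃)[3] = 1` inserted): `a ≤ s + ∂ ≤ s + d`, `d ≤ a < ⊤`. [cite: MazurRubin2004, Def. 5.2.11]
[cite: Kim2022StructureSelmer, §1.5.1 (PDF p. 7)] -/
theorem deepLower_torsionFree_of_residual
    (hR : ∀ (W : WeierstrassCurve ℚ) [W.IsElliptic] [W.IsGloballyMinimal],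
        (∀ n : ℕ, W.HasSurjectiveModNGaloisRep (3 ^ n : ℕ)) →
        Nat.card {Q : (W.baseChange ℚ_[3]).toAffine.Point // (3 : ℕ) • Q = 0} = 1 →
        Finite W.sha →
        ∀ {N : ℕ} [NeZero N] (f : CuspForm (Gamma0 N) 2), IsNewformOf W f →
        (∀ r : ℚ, ratPlusSymbol f r ≠ 0 → 0 ≤ padicValRat 3 (ratPlusSymbol f r)) →
        kuriharaVanishingOrder W 3 f = 0 →
          kuriharaPartial W 3 f 0 ≤
            (padicValNat 3 (Nat.card (AddCommGroup.primaryComponent W.sha 3)) : ℕ∞) +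
              kuriharaPartialInfty W 3 f) :
    ∀ (W : WeierstrassCurve ℚ) [W.IsElliptic] [W.IsGloballyMinimal],
        (∀ n : ℕ, W.HasSurjectiveModNGaloisRep (3 ^ n : ℕ)) →
        Nat.card {Q : (W.baseChange ℚ_[3]).toAffine.Point // (3 : ℕ) • Q = 0} = 1 →
        Finite W.sha →
        ∀ {N : ℕ} [NeZero N] (f : CuspForm (Gamma0 N) 2), IsNewformOf W f →
        (∀ r : ℚ, ratPlusSymbol f r ≠ 0 → 0 ≤ padicValRat 3 (ratPlusSymbol f r)) →
        kuriharaVanishingOrder W 3 f = 0 →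
          ∃ d : ℕ, kuriharaPartialDeepInfty W 3 f = d ∧
            kuriharaPartial W 3 f 0 ≤
              ((padicValNat 3 (Nat.card (AddCommGroup.primaryComponent W.sha 3)) + d : ℕ) : ℕ∞) := by
  intro W _ _ htower ht0 hfin N _ f hf hint hord
  have hrow := hR W htower ht0 hfin f hf hint hord
  have hfin0 : kuriharaPartial W 3 f 0 < ⊤ := by
    rw [kuriharaPartial_zero]
    exact kuriharaDivIndex_one_lt_top_of_kuriharaVanishingOrder_eq_zero W 3 f hord
  have hdfin : kuriharaPartialDeepInfty W 3 f < ⊤ :=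
    lt_of_le_of_lt (kuriharaPartialDeepInfty_le_kuriharaPartial_zero W 3 f) hfin0
  obtain ⟨d, hd⟩ : ∃ d : ℕ, kuriharaPartialDeepInfty W 3 f = d :=
    (ENat.ne_top_iff_exists.mp hdfin.ne).imp fun d h => h.symm
  refine ⟨d, hd, hrow.trans ?_⟩
  rw [Nat.cast_add, ← hd]
  exact add_le_add le_rfl (kuriharaPartialInfty_le_kuriharaPartialDeepInfty W 3 f)

/-- **Crux 19077 `ShallowEqDeepAtTorsionFree` BY NAME ⟸ crux 19076 `DeepUpperAtThree` ∧ (R)** (`s + d ≤ a ≤ s + ∂`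
gives `d ≤ ∂`; g0's `shallowEqDeepAtTorsionFree_of_deepUpperAtThree_of_minimalCertificateBound` in closed
form). [cite: Kim2022StructureSelmer, Thm. 1.9 (6), §1.5.1 (PDF p. 7)] [cite: MazurRubin2004, Thm. 5.2.12 (i)] -/
theorem shallowEqDeepAtTorsionFree_of_deepUpperAtThree_of_residual (hU : DeepUpperAtThree)
    (hR : ∀ (W : WeierstrassCurve ℚ) [W.IsElliptic] [W.IsGloballyMinimal],
        (∀ n : ℕ, W.HasSurjectiveModNGaloisRep (3 ^ n : ℕ)) →
        Nat.card {Q : (W.baseChange ℚ_[3]).toAffine.Point // (3 : ℕ) • Q = 0} = 1 →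
        Finite W.sha →
        ∀ {N : ℕ} [NeZero N] (f : CuspForm (Gamma0 N) 2), IsNewformOf W f →
        (∀ r : ℚ, ratPlusSymbol f r ≠ 0 → 0 ≤ padicValRat 3 (ratPlusSymbol f r)) →
        kuriharaVanishingOrder W 3 f = 0 →
          kuriharaPartial W 3 f 0 ≤
            (padicValNat 3 (Nat.card (AddCommGroup.primaryComponent W.sha 3)) : ℕ∞) +
              kuriharaPartialInfty W 3 f) :
    ShallowEqDeepAtTorsionFree := by
  intro W _ _ htower ht0 hfin N _ f hf hint hord
  obtain ⟨d, hd, hge⟩ := hU W htower hfin f hf hint hord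
  have h := hge.trans (hR W htower ht0 hfin f hf hint hord)
  rw [hd]
  rcases eq_or_ne (kuriharaPartialInfty W 3 f) ⊤ with htop | hne
  · rw [htop]
    exact le_top
  · lift kuriharaPartialInfty W 3 f to ℕ using hne with j hj
    have h' : padicValNat 3 (Nat.card (AddCommGroup.primaryComponent W.sha 3)) + d ≤
        padicValNat 3 (Nat.card (AddCommGroup.primaryComponent W.sha 3)) + j := by exact_mod_cast h
    exact_mod_cast (show d ≤ j by omega)

/-! ### §2 Crux 19077 from the shared parts, the off-stratum UPPER crux and the off-stratum residual -/

/-- **Crux 19077 `ShallowEqDeepAtTorsionFree` BY NAME ⟸ `KatoStratumSharedParts` (alias 19678: the five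
no-stub shared parts Sakamoto ×2, GZK, Poitou–Tate, Carayol, PORT″ 19560) ∧ crux 19562
`DeepUpperAtThreeOffKatoStratum` ∧ (R) on the off-stratum rows** (optimal-datum currency, displayed verbatim
as in `KimAtThreeShallowEqDeepOffStratumResidual`). Composition: 19562 ∧ (R)_off ⟹ 19599
(the row socket `shallowEqDeep_conclusion_of_upperRow_of_le_add_partialInfty`; = the companion file's
`shallowEqDeepOffKatoStratum_of_deepUpperOff_of_residual`), then w2-c2 g4's
`shallowEqDeepAtTorsionFree_of_katoStratumSharedParts` (= w2-c4 g4's no-stub glue). This is the seam with NO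
stub child (19561), NO 19599 and NO 19679. [cite: Kim2022StructureSelmer, Thm. 1.9 (6)] [cite: Kim2025RefinedTNC, Thm. 1.1]
[cite: MazurRubin2004, Thm. 5.2.12 (i)] -/
theorem shallowEqDeepAtTorsionFree_of_sharedParts_of_deepUpperOff_of_residualOff
    (hParts : KatoStratumSharedParts) (hU : DeepUpperAtThreeOffKatoStratum)
    (hR : ∀ (W₀ : WeierstrassCurve ℚ) [W₀.IsElliptic] [W₀.IsGloballyMinimal],
      (∀ n : ℕ, W₀.HasSurjectiveModNGaloisRep (3 ^ n : ℕ)) →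
      Nat.card {Q : (W₀.baseChange ℚ_[3]).toAffine.Point // (3 : ℕ) • Q = 0} = 1 → Finite W₀.sha →
      ∀ {N : ℕ} [NeZero N], N = W₀.conductorNorm ℤ →
      ∀ (D₀ : ModularParametrizationData W₀ N),
        (∀ z ∈ D₀.L.lattice, ∃ w ∈ periodLattice D₀.f, z = D₀.c * w) →
        (∀ (W₂ : WeierstrassCurve ℚ) [W₂.IsElliptic] (D₂ : ModularParametrizationData W₂ N),
          D₂.f = D₀.f → D₀.modularDegree ≤ D₂.modularDegree) →
        (∀ r : ℚ, ratPlusSymbol D₀.f r ≠ 0 → 0 ≤ padicValRat 3 (ratPlusSymbol D₀.f r)) →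
        kuriharaVanishingOrder W₀ 3 D₀.f = 0 →
        ¬ ((haveI : Fact (Nat.Prime 3) := ⟨Nat.prime_three⟩; Addv W₀ 3) ∧
            ¬ 3 ∣ (W₀.baseChange ℚ_[3]).localTamagawaNumber ℤ_[3] ∧ ¬ (3 : ℤ) ∣ D₀.maninConstant) →
        kuriharaPartial W₀ 3 D₀.f 0 ≤
          (padicValNat 3 (Nat.card (AddCommGroup.primaryComponent W₀.sha 3)) : ℕ∞) +
            kuriharaPartialInfty W₀ 3 D₀.f) :
    ShallowEqDeepAtTorsionFree := by
  refine shallowEqDeepAtTorsionFree_of_katoStratumSharedParts hParts ?_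
  -- 19562 ∧ (R)_off ⟹ 19599 (= `KimAtThreeShallowEqDeepOffStratumResidual.shallowEqDeepOffKatoStratum_of_deepUpperOff_of_residual`)
  intro W₀ _ _ htow ht hfin N _ hN D₀ hopt hdeg hint hord hoff
  have hoffU : ¬ ((haveI : Fact (Nat.Prime 3) := ⟨Nat.prime_three⟩; Addv W₀ 3) ∧
      ¬ 3 ∣ (W₀.baseChange ℚ_[3]).localTamagawaNumber ℤ_[3] ∧
      Nat.card {Q : (W₀.baseChange ℚ_[3]).toAffine.Point // (3 : ℕ) • Q = 0} = 1 ∧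
      ¬ (3 : ℤ) ∣ D₀.maninConstant) :=
    fun h => hoff ⟨h.1, h.2.1, h.2.2.2⟩
  exact shallowEqDeep_conclusion_of_upperRow_of_le_add_partialInfty W₀ 3 D₀.f
    (hU W₀ htow hfin hN D₀ hopt hdeg hint hord hoffU)
    (hR W₀ htow ht hfin hN D₀ hopt hdeg hint hord hoff)

end Summit.BirchSwinnertonDyer.BirchSwinnertonDyer.Theorems.KimAtThreeShallowEqDeepResidualLeaf

end
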